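import Summits.AnomalousDissipation.AnomalousDissipation.Theses.DopplerClock
import Literature.Analysis.FluidPDE.LinearizedNSTorus
import Literature.Analysis.FluidPDE.TorusClassicalLerayHopfProofs
import Summits.AnomalousDissipation.AnomalousDissipation.Theorems.DopplerClockDopplerWorkIdentity

/-!
# Line `steady-pitchfork-branch` for the crux `DopplerClock.QuadratureStressFloor` (stmt-AnomalousDissipation-18129)
# — crux-strategist, 2026-08-17 (see Cruxes/QuadratureStressFloor/STRATEGY-CENSUS.md §S1 and Lines/steady-pitchfork-branch.md)

RIGID WITNESSES. The crux's no-leak clause forces structured witnesses (census B4); kit j023236 shows that for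
the designs with a pattern harmonic (m = 2 or n = 2) the laminar streak array with drift loses stability
through a REAL, ν-UNIFORM, simple-in-`Fix(R₂)` eigenvalue (pitchfork of revolution), so x₀-dependent STEADY
drift states bifurcate and — by odd crossing / Leray–Schauder degree in the leaf × `Fix(R₂)` — exist for
small ν. The line: those secondary steady states (stub 1, existence, provable-class) are LOUD (stub 2, the
conjecture-class core: every non-laminar, non-fat, `R₂`-symmetric steady drift state of the design has a
ν-uniform dissipation floor), and loud steady drift states prove the crux (REAL PROOF: steady classical ⇒
global Leray–Hopf from itself, no-leak WITH EQUALITY, constant Cesàro means, and the STEADY form of the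
landed identity 18133 turning the dissipation floor into the quadrature stress floor).

* `stub_secondarySteadyDriftStates` — existence for all small ν of non-laminar `R₂`-symmetric steady drift
  states of the PINNED design (1,2), G = 4 (streak units `V = 1/8`, `F = π/2`) with the mild size clause
  `ν·(Ψ_s,u)² ≤ 1`.
* `stub_quietRigidity` — RIGIDITY OF QUIET STATES for that class: such states dissipate `≥ ε` below `ν₁`.
* `QuadratureStressFloor_of : stub₁ → stub₂ → QuadratureStressFloor` — REAL PROOF.
`sorry` only in the two `stub_*`.
-/

set_option linter.dupNamespace false
set_option linter.unusedVariables false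

noncomputable section

namespace Summit.AnomalousDissipation.AnomalousDissipation.Cruxes.QuadratureStressFloor.SteadyPitchforkBranch

open scoped Topology InnerProductSpace
open Filter Set MeasureTheory
open Summit.AnomalousDissipation.AnomalousDissipation.Theses.DopplerClock
open Literature.Analysis.FluidPDE Literature.Analysis.FluidPDE.Torus
open Literature.Analysis.FunctionSpaces Literature.Analysis.FunctionSpaces.Torus

local notation "𝕋³" => UnitAddTorus (Fin 3)
local notation "E³" => EuclideanSpace ℝ (Fin 3)

/-! ## §0 Vocabulary -/

/-- The route's force `f = F sin(2πm x₁) cos(2πn x₂) e₀` (character-for-character the crux's). [folklore] -/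
def force (F : ℝ) (m n : ℕ) : 𝕋³ → E³ := fun x =>
  (F * (UnitAddTorus.mFourier (Pi.single (1 : Fin 3) (m : ℤ)) x).im *
      (UnitAddTorus.mFourier (Pi.single (2 : Fin 3) (n : ℤ)) x).re) •
    EuclideanSpace.single (0 : Fin 3) (1 : ℝ)

/-- The quadrature streak pattern `Ψ_s = sin(2πm x₁) sin(2πn x₂) e₀`. [folklore] -/
def psiS (m n : ℕ) : 𝕋³ → E³ := fun y =>
  ((UnitAddTorus.mFourier (Pi.single (1 : Fin 3) (m : ℤ)) y).im *
      (UnitAddTorus.mFourier (Pi.single (2 : Fin 3) (n : ℤ)) y).im) •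
    EuclideanSpace.single (0 : Fin 3) (1 : ℝ)

/-- The drift (conserved momentum) `V e₂`. [folklore] -/
def drift (V : ℝ) : E³ := V • EuclideanSpace.single (2 : Fin 3) (1 : ℝ)

/-- The injection `(f, v)`. [folklore] -/
def injection (F : ℝ) (m n : ℕ) (v : 𝕋³ → E³) : ℝ := ∫ x, ⟪force F m n x, v x⟫_ℝ

/-- The quadrature stress `T_s(w) = ∫ ⟪w, (w·∇)Ψ_s⟫`, `w = v − V e₂` (production of the fluctuation on
the frozen streak profile is `−(F/2πnV)·T_s`). [folklore] -/
def stressS (V : ℝ) (m n : ℕ) (v : 𝕋³ → E³) : ℝ :=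
  ∫ x, ⟪v x - drift V, convect (fun y => v y - drift V) (psiS m n) x⟫_ℝ

/-- The laminar streak array `u_L(ν) = V e₂ + sin(2πm x₁)[a cos(2πn x₂) + b sin(2πn x₂)] e₀` of item
`LaminarStreaks` (`a = Fνκ²/D`, `b = FV(2πn)/D`, `D = V²(2πn)² + ν²κ⁴`, `κ² = 4π²(m²+n²)`). [folklore] -/
def laminar (F V ν : ℝ) (m n : ℕ) : 𝕋³ → E³ := fun x =>
  V • EuclideanSpace.single (2 : Fin 3) (1 : ℝ) +
    ((UnitAddTorus.mFourier (Pi.single (1 : Fin 3) (m : ℤ)) x).im *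
        ((F * ν * ((2 * Real.pi) ^ 2 * ((m : ℝ) ^ 2 + (n : ℝ) ^ 2)) /
              (V ^ 2 * (2 * Real.pi * n) ^ 2 + ν ^ 2 * ((2 * Real.pi) ^ 2 * ((m : ℝ) ^ 2 + (n : ℝ) ^ 2)) ^ 2)) *
            (UnitAddTorus.mFourier (Pi.single (2 : Fin 3) (n : ℤ)) x).re +
          (F * V * (2 * Real.pi * n) /
              (V ^ 2 * (2 * Real.pi * n) ^ 2 + ν ^ 2 * ((2 * Real.pi) ^ 2 * ((m : ℝ) ^ 2 + (n : ℝ) ^ 2)) ^ 2)) *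
            (UnitAddTorus.mFourier (Pi.single (2 : Fin 3) (n : ℤ)) x).im)) •
      EuclideanSpace.single (0 : Fin 3) (1 : ℝ)

/-- The crux BY NAME in this vocabulary (definitional). [folklore] -/
theorem crux_iff :
    QuadratureStressFloor ↔
      ∃ (F V : ℝ) (m n : ℕ), 0 < F ∧ 0 < V ∧ 0 < m ∧ 0 < n ∧ ∃ Λ : GeneralizedLimit,
        ∃ (ν : ℕ → ℝ) (u₀ : ℕ → 𝕋³ → E³) (u : ℕ → ℝ → 𝕋³ → E³),
          (∀ j, 0 < ν j) ∧ Tendsto ν atTop (𝓝 0) ∧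
          (∀ j, IsGlobalLerayHopf (ν j) (fun _ => force F m n) (u₀ j) (u j)) ∧
          (∀ j, ∫ x, u₀ j x = drift V) ∧
          (∀ j, ∃ C : ℝ, ∀ t : ℝ, 0 ≤ t → kineticEnergy (u j t) ≤ C) ∧
          (∀ j, longTimeAvgSup (fun t => injection F m n (u j t)) ≤ meanDissipation (ν j) (u j)) ∧
          ∃ ε₀ : ℝ, 0 < ε₀ ∧ ∀ j, ε₀ ≤ -Λ.longTimeAvg (fun t => stressS V m n (u j t)) :=
  Iff.rfl

/-! ## Junk-free calculus of constant-in-time observables (steady witnesses have honest means) -/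

/-- Cesàro mean of a constant over `[0,T]`, `T ≠ 0`. [folklore] -/
theorem timeMean_const {c T : ℝ} (hT : T ≠ 0) : timeMean (fun _ => c) T = c := by
  unfold timeMean
  rw [intervalIntegral.integral_const, sub_zero, smul_eq_mul, ← mul_assoc, inv_mul_cancel₀ hT, one_mul]

/-- The Cesàro means of a constant tend to it. [folklore] -/
theorem tendsto_timeMean_const (c : ℝ) : Tendsto (timeMean fun _ => c) atTop (𝓝 c) := by
  refine tendsto_const_nhds.congr' ?_
  filter_upwards [eventually_gt_atTop 0] with T hT
  exact (timeMean_const (c := c) hT.ne').symm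

/-- `⟨c⟩⁺ = c`. [folklore] -/
theorem longTimeAvgSup_const (c : ℝ) : longTimeAvgSup (fun _ => c) = c :=
  (tendsto_timeMean_const c).limsup_eq

/-- `⟨c⟩_Λ = c` for every generalized limit. [folklore] -/
theorem longTimeAvg_const (Λ : GeneralizedLimit) (c : ℝ) : Λ.longTimeAvg (fun _ => c) = c :=
  Λ.longTimeAvg_eq_of_tendsto (tendsto_timeMean_const c)

/-- The steady energy identity `ν‖∇u‖² = (f, u)` for a classical steady state. [folklore] -/
theorem steady_energy_identity {ν : ℝ} {f u : 𝕋³ → E³} {p : 𝕋³ → ℝ}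
    (h : IsClassicalNSSolutionOn Set.univ ν (fun _ => f) (fun _ => u) (fun _ => p)) :
    ν * gradNormSq u = ∫ x, ⟪f x, u x⟫_ℝ := by
  have hE := h.energy_eq convex_univ (zero_le_one (α := ℝ)) (Set.subset_univ _)
  simp only [intervalIntegral.integral_const, sub_zero, one_smul] at hE
  linarith

/-! ## §S Strengthen — rigid (steady / relative-equilibrium) witnesses -/

/-- **S⁺_steady (typed; conjecture-class).** For some design `(F,V,m,n)` there are `ν_j → 0⁺` and
smooth STEADY states `u_j` of `NS_{ν_j}(f)` with momentum `V e₂` and a quadrature stress floor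
`ε₀ ≤ −T_s(u_j − V e₂)`. Energy is NOT bounded (as in the crux). [folklore] -/
def SteadyStressFloorStates : Prop :=
  ∃ (F V : ℝ) (m n : ℕ), 0 < F ∧ 0 < V ∧ 0 < m ∧ 0 < n ∧
    ∃ (ν : ℕ → ℝ) (u : ℕ → 𝕋³ → E³) (p : ℕ → 𝕋³ → ℝ),
      (∀ j, 0 < ν j) ∧ Tendsto ν atTop (𝓝 0) ∧
      (∀ j, IsSteadyNSState (ν j) (force F m n) (u j) (p j)) ∧
      (∀ j, ∫ x, u j x = drift V) ∧
      ∃ ε₀ : ℝ, 0 < ε₀ ∧ ∀ j, ε₀ ≤ -stressS V m n (u j)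

/-- **Steady loud drift states prove the crux** (PROVED): a classical steady state is a global
Leray–Hopf solution from itself (`IsClassicalNSSolutionOn.isGlobalLerayHopf`), its energy is
constant, the no-leak clause holds WITH EQUALITY (`(f,u) = ν‖∇u‖²`, steady energy identity, and
`‖∇u‖² = ‖∇u‖²_spectral` on smooth fields), and every long-time mean of a constant observable is that
constant — for ANY generalized limit `Λ`. [folklore] -/
theorem crux_of_steady (h : SteadyStressFloorStates) : QuadratureStressFloor := by
  obtain ⟨F, V, m, n, hF, hV, hm, hn, ν, u, p, hν, hν0, hst, hmom, ε₀, hε₀, hfloor⟩ := h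
  obtain ⟨Λ⟩ := GeneralizedLimit.nonempty_holds
  rw [crux_iff]
  refine ⟨F, V, m, n, hF, hV, hm, hn, Λ, ν, u, fun j _ => u j, hν, hν0, fun j => (hst j).isGlobalLerayHopf,
    hmom, fun j => ⟨kineticEnergy (u j), fun t _ => le_rfl⟩, fun j => ?_, ε₀, hε₀, fun j => ?_⟩
  · -- no-leak with equality
    have hsm : IsSmooth (u j) := (hst j).smooth_velocity.isSmooth_slice (Set.mem_univ (0 : ℝ))
    have hid : ν j * gradNormSq (u j) = injection F m n (u j) := steady_energy_identity (hst j)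
    show longTimeAvgSup (fun _ : ℝ => injection F m n (u j)) ≤
      longTimeAvgSup (fun _ : ℝ => ν j * (eGradNormSq (u j)).toReal)
    rw [longTimeAvgSup_const, longTimeAvgSup_const, ← gradNormSq_eq_toReal_eGradNormSq_holds hsm, hid]
  · show ε₀ ≤ -Λ.longTimeAvg (fun _ : ℝ => stressS V m n (u j))
    rw [longTimeAvg_const]
    exact hfloor j

/-! ### The steady form of the landed identity: on rigid states "loud" is ONE signed functional -/

/-- The quadrature streak coefficient `B(v) = (Ψ_s, v)`. [folklore] -/
def quadB (m n : ℕ) (v : 𝕋³ → E³) : ℝ := ∫ x, ⟪psiS m n x, v x⟫_ℝ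

/-- **Steady Doppler work identity** (PROVED from the landed `dopplerWorkIdentity_proof`, item 18133):
for a smooth steady state `U` of `NS_ν(f)` (any momentum), `(f,U) = F/(V·2πn)·(νκ²(Ψ_s,U) − T_s(U − Ve₂))` —
the rotation identity `B' = ωA + T_s − νκ²B` with `B' = 0`. [folklore] -/
theorem steady_work_identity {F V ν : ℝ} {m n : ℕ} {U : 𝕋³ → E³} {p : 𝕋³ → ℝ}
    (hV : 0 < V) (hν : 0 < ν) (hn : 0 < n) (hst : IsSteadyNSState ν (force F m n) U p)
    (hmom : ∫ x, U x = drift V) :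
    injection F m n U =
      F / (V * (2 * Real.pi * n)) *
        (ν * ((2 * Real.pi) ^ 2 * ((m : ℝ) ^ 2 + (n : ℝ) ^ 2)) * quadB m n U - stressS V m n U) := by
  obtain ⟨Λ⟩ := GeneralizedLimit.nonempty_holds
  have h := Summit.AnomalousDissipation.AnomalousDissipation.Theorems.dopplerWorkIdentity_proof Λ F V ν m n U
    (fun _ => U) hV hν hn hst.isGlobalLerayHopf hmom ⟨kineticEnergy U, fun t _ => le_rfl⟩
  simp only [longTimeAvg_const] at h
  exact h

/-- **On steady drift states a DISSIPATION floor is a quadrature STRESS floor** (PROVED): if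
`ε ≤ ν‖∇U‖²` and `νκ²·|(Ψ_s,U)| ≤ δ` then `(2πnV/F)·ε − δ ≤ −T_s(U − Ve₂)` (steady energy identity
`ν‖∇U‖² = (f,U)` + `steady_work_identity`). So loudness of rigid witnesses is the sign/size of ONE
quadratic functional, and energies up to `o(ν⁻²)` are harmless. [folklore] -/
theorem steady_stressFloor_of_dissipationFloor {F V ν ε δ : ℝ} {m n : ℕ} {U : 𝕋³ → E³} {p : 𝕋³ → ℝ}
    (hF : 0 < F) (hV : 0 < V) (hν : 0 < ν) (hn : 0 < n) (hst : IsSteadyNSState ν (force F m n) U p)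
    (hmom : ∫ x, U x = drift V) (hε : ε ≤ ν * gradNormSq U)
    (hδ : ν * ((2 * Real.pi) ^ 2 * ((m : ℝ) ^ 2 + (n : ℝ) ^ 2)) * |quadB m n U| ≤ δ) :
    V * (2 * Real.pi * n) / F * ε - δ ≤ -stressS V m n U := by
  have hid : ν * gradNormSq U = injection F m n U := steady_energy_identity hst
  have hw := steady_work_identity hV hν hn hst hmom
  set κ2 : ℝ := (2 * Real.pi) ^ 2 * ((m : ℝ) ^ 2 + (n : ℝ) ^ 2) with hκ2
  set ω : ℝ := V * (2 * Real.pi * n) with hω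
  have hn' : (0 : ℝ) < n := by exact_mod_cast hn
  have hωpos : 0 < ω := by rw [hω]; positivity
  have hκ2 : 0 ≤ κ2 := by rw [hκ2]; positivity
  -- `−T_s = (ω/F)·(f,U) − νκ²B`
  have hT : -stressS V m n U = ω / F * injection F m n U - ν * κ2 * quadB m n U := by
    rw [hw]
    field_simp
    ring
  have hB : -(ν * κ2 * quadB m n U) ≥ -δ := by
    have h1 : ν * κ2 * quadB m n U ≤ ν * κ2 * |quadB m n U| :=
      mul_le_mul_of_nonneg_left (le_abs_self _) (mul_nonneg hν.le hκ2)
    linarith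
  have hI : ω / F * ε ≤ ω / F * injection F m n U :=
    mul_le_mul_of_nonneg_left (hid ▸ hε) (div_nonneg hωpos.le hF.le)
  rw [hT]
  have : V * (2 * Real.pi * ↑n) / F * ε = ω / F * ε := by rw [hω]
  linarith

/-- **S⁺ in dissipation form (typed): loud steady drift states.** Some design, `ν_j → 0⁺`, smooth steady
states with momentum `V e₂`, a ν-uniform DISSIPATION floor `ε ≤ ν_j‖∇u_j‖²`, and the mild size condition
`ν_j κ² |(Ψ_s,u_j)| ≤ δ` with `δ < (2πnV/F)·ε` (energies `o(ν⁻²)` suffice). [folklore] -/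
def SteadyLoudDriftStates : Prop :=
  ∃ (F V : ℝ) (m n : ℕ), 0 < F ∧ 0 < V ∧ 0 < m ∧ 0 < n ∧
    ∃ (ν : ℕ → ℝ) (u : ℕ → 𝕋³ → E³) (p : ℕ → 𝕋³ → ℝ),
      (∀ j, 0 < ν j) ∧ Tendsto ν atTop (𝓝 0) ∧
      (∀ j, IsSteadyNSState (ν j) (force F m n) (u j) (p j)) ∧
      (∀ j, ∫ x, u j x = drift V) ∧
      ∃ ε δ : ℝ, 0 < ε ∧ δ < V * (2 * Real.pi * n) / F * ε ∧
        (∀ j, ε ≤ ν j * gradNormSq (u j)) ∧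
        ∀ j, ν j * ((2 * Real.pi) ^ 2 * ((m : ℝ) ^ 2 + (n : ℝ) ^ 2)) * |quadB m n (u j)| ≤ δ

/-- Loud steady drift states have a quadrature stress floor (PROVED), hence prove the crux
(`crux_of_steady`). [folklore] -/
theorem steadyStressFloor_of_loud (h : SteadyLoudDriftStates) : SteadyStressFloorStates := by
  obtain ⟨F, V, m, n, hF, hV, hm, hn, ν, u, p, hν, hν0, hst, hmom, ε, δ, hε, hδε, hfl, hB⟩ := h
  refine ⟨F, V, m, n, hF, hV, hm, hn, ν, u, p, hν, hν0, hst, hmom, V * (2 * Real.pi * n) / F * ε - δ,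
    by linarith, fun j => ?_⟩
  exact steady_stressFloor_of_dissipationFloor hF hV (hν j) hn (hst j) (hmom j) (hfl j) (hB j)

/-- COMPOSITION (PROVED): loud steady drift states ⟹ the crux by name. [folklore] -/
theorem crux_of_loudSteady (h : SteadyLoudDriftStates) : QuadratureStressFloor :=
  crux_of_steady (steadyStressFloor_of_loud h)

/-! ### Existence side of the steady line (after kit j023236: REAL, ν-uniform pitchfork crossings for m = 2 or n = 2) -/

/-- The reflection `R₂ : x ↦ Sx`, `S = diag(−1,−1,1)`, on the torus. [folklore] -/
def reflS (x : 𝕋³) : 𝕋³ := fun i => if i = 2 then x i else -x i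

/-- `S = diag(−1,−1,1)` on velocity values. [folklore] -/
def vecS (v : E³) : E³ := !₂[-(v 0), -(v 1), v 2]

/-- `u` is `R₂`-symmetric: `S u(Sx) = u(x)`, i.e. `u(Sx) = S u(x)` (the force `f`, the drift `V e₂` and the
laminar streaks are `R₂`-symmetric; in `Fix(R₂)` the `x₀`-phase orbit of a pitchfork of revolution is cut
to a point and the real crossing is simple). [folklore] -/
def IsR2Symmetric (u : 𝕋³ → E³) : Prop := ∀ x, u (reflS x) = vecS (u x)

/-- **Bifurcation of steady drift states from the laminar branch (typed; provable-class given a certified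
simple real crossing — Crandall–Rabinowitz / Krasnosel'skii odd crossing in `Fix(R₂)`):** for some design
there is `ν_c > 0` such that NON-laminar `R₂`-symmetric steady drift states accumulate at `(ν_c, u_L(ν_c))`.
Kit j023236: real simple-in-sector crossings at `ν_c ≈ 0.01` (streak units) for (1,2) G=4 and (2,1) G=16. [folklore] -/
def LaminarPitchforkPoint : Prop :=
  ∃ (F V : ℝ) (m n : ℕ), 0 < F ∧ 0 < V ∧ 0 < m ∧ 0 < n ∧ ∃ ν_c : ℝ, 0 < ν_c ∧
    ∀ ε : ℝ, 0 < ε → ∃ (ν : ℝ) (u : 𝕋³ → E³) (p : 𝕋³ → ℝ), |ν - ν_c| < ε ∧ 0 < ν ∧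
      IsSteadyNSState ν (force F m n) u p ∧ (∫ x, u x = drift V) ∧ IsR2Symmetric u ∧
      u ≠ laminar F V ν m n ∧ ∀ x, ‖u x - laminar F V ν m n x‖ < ε

/-- **Secondary steady drift states for all small ν (typed; provable-class modulo certified spectral
counts: Leray–Schauder index −1 of the laminar state in `Fix(R₂)` on ν-intervals with an odd number of real
unstable modes, or Rabinowitz's global alternative (i) for the pitchfork continuum):** for some design and
all `0 < ν < ν₀` there is an `R₂`-symmetric steady drift state different from the laminar one (hence
`x₀`-dependent, the `x₀`-invariant steady class being `{u_L(ν)}`). [folklore] -/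
def SecondarySteadyDriftStates : Prop :=
  ∃ (F V : ℝ) (m n : ℕ), 0 < F ∧ 0 < V ∧ 0 < m ∧ 0 < n ∧ ∃ ν₀ : ℝ, 0 < ν₀ ∧
    ∀ ν : ℝ, 0 < ν → ν < ν₀ → ∃ (u : 𝕋³ → E³) (p : 𝕋³ → ℝ),
      IsSteadyNSState ν (force F m n) u p ∧ (∫ x, u x = drift V) ∧ IsR2Symmetric u ∧ u ≠ laminar F V ν m n

/-! ## The two registered stubs and the composition

The design is PINNED to the census's TABLE D1 choice (m,n) = (1,2), clock number G = 4, in streak units: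
`V = 1/8`, `F = π/2` (limiting streak amplitude `F/(V·2πn) = 1`, `2πnV/F = 1`), `κ² = 20π²`; every other
admissible `(F,V)` of this shape is scale-equivalent (census B7). -/

/-- Pinned design: amplitude `F = π/2`. [folklore] -/
def F₀ : ℝ := Real.pi / 2

/-- Pinned design: drift `V = 1/8`. [folklore] -/
def V₀ : ℝ := 1 / 8

/-- Signature of `stub_secondarySteadyDriftStates` (EXISTENCE; provable-class: the laminar streak array of
the pinned design loses stability at `ν_c ≈ 0.01` through a REAL eigenvalue, simple in `Fix(R₂)`, with
ν-uniform rate `σ₀ ≈ 1.56` (kit j023236) — Crandall–Rabinowitz pitchfork + Leray–Schauder index `−1` of the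
laminar state in the leaf × `Fix(R₂)` / Rabinowitz's global alternative give non-laminar `R₂`-symmetric
steady drift states for all small `ν`; the size clause `ν·(Ψ_s,u)² ≤ 1` holds with room for every state of
energy `≤ 4/ν`). -/
def Sig.stub_secondarySteadyDriftStates : Prop :=
  ∃ ν₀ : ℝ, 0 < ν₀ ∧ ∀ ν : ℝ, 0 < ν → ν < ν₀ → ∃ (u : 𝕋³ → E³) (p : 𝕋³ → ℝ),
    IsSteadyNSState ν (force F₀ 1 2) u p ∧ (∫ x, u x = drift V₀) ∧ IsR2Symmetric u ∧
    u ≠ laminar F₀ V₀ ν 1 2 ∧ ν * (quadB 1 2 u) ^ 2 ≤ 1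

/-- Signature of `stub_quietRigidity` (THE CORE; conjecture-class, killable by ONE quiet state: rigidity of
quiet steady drift states of the pinned design): below some `ν₁` every non-laminar, `R₂`-symmetric steady
drift state with `ν·(Ψ_s,u)² ≤ 1` dissipates at least `ε`: `ε ≤ ν‖∇u‖²`. Under kit test j023495 (the
pitchfork branch's `D(ν)`). -/
def Sig.stub_quietRigidity : Prop :=
  ∃ ν₁ ε : ℝ, 0 < ν₁ ∧ 0 < ε ∧ ∀ (ν : ℝ) (u : 𝕋³ → E³) (p : 𝕋³ → ℝ), 0 < ν → ν < ν₁ →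
    IsSteadyNSState ν (force F₀ 1 2) u p → (∫ x, u x = drift V₀) → IsR2Symmetric u →
    u ≠ laminar F₀ V₀ ν 1 2 → ν * (quadB 1 2 u) ^ 2 ≤ 1 → ε ≤ ν * gradNormSq u

/-- STUB 1 (existence; provable-class). -/
theorem stub_secondarySteadyDriftStates : Sig.stub_secondarySteadyDriftStates := by
  sorry

/-- STUB 2 (the core; conjecture-class). -/
theorem stub_quietRigidity : Sig.stub_quietRigidity := by
  sorry

/-- The pinned design has `2πnV/F = 1`. [folklore] -/
theorem design_ratio : V₀ * (2 * Real.pi * (2 : ℕ)) / F₀ = 1 := by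
  unfold V₀ F₀
  have hπ : Real.pi ≠ 0 := Real.pi_ne_zero
  field_simp
  push_cast
  ring

/-- From the size clause `ν B² ≤ 1` and `ν ≤ (ε/(2κ²))²`: `νκ²|B| ≤ ε/2`. [folklore] -/
theorem size_clause_bound {ν ε κ2 B : ℝ} (hν : 0 < ν) (hε : 0 < ε) (hκ : 0 < κ2)
    (hB : ν * B ^ 2 ≤ 1) (hνε : ν ≤ (ε / (2 * κ2)) ^ 2) : ν * κ2 * |B| ≤ ε / 2 := by
  have h0 : 0 ≤ ν * κ2 * |B| := by positivity
  have h1 : (ν * κ2 * |B|) ^ 2 ≤ (ε / 2) ^ 2 := by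
    have hsq : (ν * κ2 * |B|) ^ 2 = κ2 ^ 2 * ν * (ν * B ^ 2) := by
      rw [mul_pow, mul_pow, sq_abs]; ring
    rw [hsq]
    have h2 : κ2 ^ 2 * ν * (ν * B ^ 2) ≤ κ2 ^ 2 * ν * 1 :=
      mul_le_mul_of_nonneg_left hB (by positivity)
    have h3 : κ2 ^ 2 * ν ≤ κ2 ^ 2 * (ε / (2 * κ2)) ^ 2 := mul_le_mul_of_nonneg_left hνε (by positivity)
    have h4 : κ2 ^ 2 * (ε / (2 * κ2)) ^ 2 = (ε / 2) ^ 2 := by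
      field_simp
    nlinarith [h2, h3, h4]
  have hε2 : 0 ≤ ε / 2 := by positivity
  rw [← Real.sqrt_sq h0, ← Real.sqrt_sq hε2]
  exact Real.sqrt_le_sqrt h1

/-- COMPOSITION (real proof): secondary steady drift states for all small ν + rigidity of quiet states ⇒
loud steady drift states along `ν_j = ν⋆/(j+2) → 0` (with `ν⋆` small enough for the size clause to give
`νκ²|(Ψ_s,u)| ≤ ε/2 < (2πnV/F)ε = ε`) ⇒ the crux BY NAME via `crux_of_loudSteady`. -/
theorem QuadratureStressFloor_of (h₁ : Sig.stub_secondarySteadyDriftStates) (h₂ : Sig.stub_quietRigidity) :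
    Summit.AnomalousDissipation.AnomalousDissipation.Theses.DopplerClock.QuadratureStressFloor := by
  obtain ⟨ν₀, hν₀, hex⟩ := h₁
  obtain ⟨ν₁, ε, hν₁, hε, hrig⟩ := h₂
  set κ2 : ℝ := (2 * Real.pi) ^ 2 * (((1 : ℕ) : ℝ) ^ 2 + ((2 : ℕ) : ℝ) ^ 2) with hκ2def
  have hκ2 : 0 < κ2 := by rw [hκ2def]; positivity
  -- the starting viscosity
  set νs : ℝ := min ν₀ (min ν₁ ((ε / (2 * κ2)) ^ 2)) with hνs
  have hνs0 : 0 < νs := by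
    rw [hνs]
    refine lt_min hν₀ (lt_min hν₁ ?_)
    positivity
  have hνs₀ : νs ≤ ν₀ := min_le_left _ _
  have hνs₁ : νs ≤ ν₁ := (min_le_right _ _).trans (min_le_left _ _)
  have hνsε : νs ≤ (ε / (2 * κ2)) ^ 2 := (min_le_right _ _).trans (min_le_right _ _)
  -- the vanishing-viscosity sequence inside `(0, νs)`
  set ν : ℕ → ℝ := fun j => νs / ((j : ℝ) + 2) with hνdef
  have hνpos : ∀ j, 0 < ν j := fun j => by rw [hνdef]; positivity
  have hνlt : ∀ j, ν j < νs := fun j => by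
    rw [hνdef]
    have h2 : (1 : ℝ) < (j : ℝ) + 2 := by
      have : (0 : ℝ) ≤ (j : ℝ) := Nat.cast_nonneg j
      linarith
    exact div_lt_self hνs0 h2
  have hν0 : Tendsto ν atTop (𝓝 0) := by
    rw [hνdef]
    have h := tendsto_const_div_atTop_nhds_zero_nat νs
    have h' : Tendsto (fun j : ℕ => νs / ((j + 2 : ℕ) : ℝ)) atTop (𝓝 0) :=
      h.comp (tendsto_add_atTop_nat 2)
    refine h'.congr' (Eventually.of_forall fun j => ?_)
    push_cast
    ring_nf
  -- the steady states, their floor and the size bound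
  choose u p hst hmom hsym hne hsize using
    fun j => hex (ν j) (hνpos j) ((hνlt j).trans_le hνs₀)
  have hfloor : ∀ j, ε ≤ ν j * gradNormSq (u j) := fun j =>
    hrig (ν j) (u j) (p j) (hνpos j) ((hνlt j).trans_le hνs₁) (hst j) (hmom j) (hsym j) (hne j) (hsize j)
  have hB : ∀ j, ν j * κ2 * |quadB 1 2 (u j)| ≤ ε / 2 := fun j =>
    size_clause_bound (hνpos j) hε hκ2 (hsize j) ((hνlt j).le.trans hνsε)
  have hF : 0 < F₀ := by unfold F₀; positivity
  have hV : 0 < V₀ := by unfold V₀; positivity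
  have hδ : ε / 2 < V₀ * (2 * Real.pi * (2 : ℕ)) / F₀ * ε := by
    rw [design_ratio]; linarith
  have hloud : SteadyLoudDriftStates :=
    ⟨F₀, V₀, 1, 2, hF, hV, Nat.one_pos, two_pos, ν, u, p, hνpos, hν0, hst, hmom, ε, ε / 2, hε, hδ,
      hfloor, fun j => by simpa [hκ2def] using hB j⟩
  exact crux_of_loudSteady hloud

/-- The crux modulo the two registered stubs. -/
theorem QuadratureStressFloor_proof :
    Summit.AnomalousDissipation.AnomalousDissipation.Theses.DopplerClock.QuadratureStressFloor :=
  QuadratureStressFloor_of stub_secondarySteadyDriftStates stub_quietRigidity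

end Summit.AnomalousDissipation.AnomalousDissipation.Cruxes.QuadratureStressFloor.SteadyPitchforkBranch

end
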